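/-
Copyright (c) 2026 the pub-hodgecm-mathlib formalisation cell (harness21).  Prover seat hodgecm-mathlib-K2Liu-p23 (g3), Track B «K2-LIT»,
#184♮ = hLiu418 = `stmt-HodgeConjecture-24832`; K1-a♮ (Iw-S₀) road (R2′), FILE D (K1a desk K2Liu-p01 (g11) WORD #2 (2), 2026-09-05T02:08:16Z):
AT EVERY FINITE PLACE THE DOUBLED UNITARY GROUP HAS A COMPACT OPEN SUBGROUP WITH THE LOCAL IWASAWA DECOMPOSITION.
KERNEL: theorems only.
-/
import Summits.HodgeConjecture.HodgeConjecture.Theorems.K2LiuLocalSiegelIwasawa                 -- ★ (K2Liu-p01): `isSiegelDelta_frameConj`, the frame algebra (file (4a)), ★ `exists_upper_mul_mem_localInt`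
import Literature.NumberTheory.GelbartRogawski1991.DoubledWeilRepresentationLocalFamilyCM   -- ★ `gramR_isSymm`, `hermD_eq_map_gramD`, `isUnit_det_gramR₀`, `imagUnit` letters (the CM datum)
import HarnessLib

/-!
# Crux `HLiu418`, K1-a♮ (Iw-S₀) road (R2′), FILE D: A COMPACT OPEN IWASAWA SUBGROUP OF `H(F_v) = U(T₀ ⊕ −T₀)(F_v)` AT EVERY FINITE PLACE

Cell `hodgecm-mathlib`, crux item hLiu418 = `stmt-HodgeConjecture-24832` (helper lane `--supports stmt-HodgeConjecture-24832 --as helper`, count-neutral; closes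
no socket); K1a desk K2Liu-p01 (g11) (road (R2′) «monomial-flat at ★ p863501's interface», FILES A–D).  THEOREMS ONLY (no `def`, no `instance`, no `notation`,
no named-fact hypothesis, no `sorry`).

WHAT.  ★ `K2LiuLocalSiegelIwasawa.exists_isSiegelDelta_mul_mem_localInt` (K2Liu-p01) gives `H(F_v) = P_Δ(F_v) · H(𝒪_v)` at GOOD places only (`|2|_w = 1`, `T₀^{±1}`
integral), because it insists on the compact `H(𝒪_v)`.  Road (R2′) needs, at EVERY finite place, SOME compact open `K₁ ≤ H(F_v)` with `H(F_v) = P_Δ(F_v) · K₁` — and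
that is FREE: the rational frame `Q = e₂ ∘ (1 D; 1 −D)`, `D = ½ T₀⁻¹ W` (`Qᵀ (T₀ ⊕ −T₀) Q = J_{2n}`), gives the homeomorphic group isomorphism ★
`FrameTransport.frameConj Q : U(J_{2n})(F_v) ≃ₜ* H(F_v)` carrying the upper triangular Borel into `P_Δ` (★ `isSiegelDelta_frameConj`), and the quasi-split group has
`U(J_{2n})(F_v) = B · U(J_{2n})(𝒪_v)` at EVERY finite place (★ `UnitaryGroup.exists_upper_mul_mem_localInt`); so **`K₁ := frameConj_Q (U(J_{2n})(𝒪_v))`** is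
compact (★ `isCompact_localInt`, continuous image), open (homeomorphism, ★ `isOpen_localInt`) and Iwasawa — with NO integrality of `Q` needed (that was only used to
land inside `H(𝒪_v)`).
* §1 (generic doubled datum `E/F`, `c`, `δ`, `T₀` symmetric invertible, any finite `v`) **`exists_isCompact_isOpen_iwasawa`** —
  `∃ K₁ ≤ H(F_v), (IsCompact K₁ ∧ IsOpen K₁) ∧ ∀ g, ∃ p, IsSiegelDelta p ∧ ∃ k ∈ K₁, g = p·k`.
* §2 (the CM doubled datum `(L, e, dV, dW)`) **`exists_isCompact_isOpen_iwasawa_cm`** — the same in ★ p863501 `exists_localFace_kindOneSingular`'s binder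
  shape `(K₀) (hK₀ : IsCompact K₀ ∧ IsOpen K₀) (hIw : haveI := IsCMField.isQuadraticExtension L; ∀ g, ∃ p, IsSiegelDelta (Fp L) L … v n (gramR_isSymm …)
  (hermD_eq_map_gramD …) p ∧ ∃ k ∈ K₀, g = p * k)` EXACTLY (at `n = 2`: road (R2′) FILE C's per-place `K₁ hK₁ hIw`, class-free, every place).
References: [BruhatTits1972] Prop. (4.4.3) (Iwasawa decomposition); [Tits1979] §3.3.2; [Casselman1980] §3; [HarrisKudlaSweet1996] §1 (1.11) (`P_Δ`);
[PlatonovRapinchuk1994] §2.3, §5.1 (frame transport, `G(𝒪_v)` compact open).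
HONEST LABEL.  Count-neutral helper: `HC_CM` is proved only modulo the 7 printed citations (2 remaining named inputs: hLiu418 = `stmt-HodgeConjecture-24832`,
h413 = `stmt-HodgeConjecture-24833`) until rung 0 closes; this file closes no socket.
-/

set_option autoImplicit false
set_option linter.dupNamespace false -- the mandated namespace repeats `HodgeConjecture.HodgeConjecture`

noncomputable section

open NumberField IsDedekindDomain Matrix
open Literature.NumberTheory.Automorphic Literature.NumberTheory.Automorphic.UnitaryGroup
open Literature.NumberTheory.GelbartRogawski1991.AdaptedBlocks
open Literature.NumberTheory.GelbartRogawski1991.UnitaryDualPair.LocalSplitting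
open Summit.HodgeConjecture.HodgeConjecture.Cruxes.HLiu418.K2LiuLocalSiegelIwasawaFrame
open Summit.HodgeConjecture.HodgeConjecture.Cruxes.HLiu418.K2LiuLocalSiegelIwasawa

namespace Summit.HodgeConjecture.HodgeConjecture.Cruxes.HLiu418.K2LiuLocalIwasawaCompact

/-! ## §1 Generic doubled datum: a compact open Iwasawa subgroup at every finite place -/

section Generic

variable (F : Type) [Field F] [NumberField F] (E : Type) [Field E] [NumberField E] [Algebra F E]
  [Algebra.IsQuadraticExtension F E] (c : E ≃ₐ[F] E)
  {δ : E} (hcδ : c δ = -δ) (hδ : δ ≠ 0) {d : F} (hd : δ * δ = algebraMap F E d)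
  (v : HeightOneSpectrum (𝓞 F)) (n : ℕ) {T₀ : Matrix (Fin n) (Fin n) F} (hT₀ : T₀.IsSymm)
  {JD : Matrix (Fin (n + n)) (Fin (n + n)) E} (hJD : JD = (gramD F n T₀).map (algebraMap F E))

include hcδ hδ hd hT₀ hJD in
/-- **A COMPACT OPEN IWASAWA SUBGROUP OF THE DOUBLED UNITARY GROUP AT EVERY FINITE PLACE.**  For `T₀ ∈ Sym_n(F)` invertible and ANY finite place `v` of `F`
there is a compact open subgroup `K₁ ≤ H(F_v) = U(T₀ ⊕ −T₀)(F_v)` with `H(F_v) = P_Δ(F_v) · K₁`: `K₁ = frameConj_Q (U(J_{2n})(𝒪_v))`, the transport of the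
hyperspecial-type compact of the quasi-split form `J_{2n}` along the rational frame `Q` (`Qᵀ (T₀ ⊕ −T₀) Q = J_{2n}`; ★ `isSiegelDelta_frameConj` puts the Borel into
`P_Δ`, ★ `UnitaryGroup.exists_upper_mul_mem_localInt` is the Iwasawa decomposition of `U(J_{2n})(F_v)` at every finite place).  No integrality of `Q` at `v` is
needed. [cite: BruhatTits1972, Prop. (4.4.3)] [cite: Tits1979, §3.3.2] [cite: Casselman1980, §3] [cite: PlatonovRapinchuk1994, §2.3, §5.1] -/
theorem exists_isCompact_isOpen_iwasawa (hT₀d : IsUnit T₀.det) :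
    ∃ K₁ : Subgroup (UnitaryGroup.localPi E c (n + n) JD v),
      (IsCompact (K₁ : Set (UnitaryGroup.localPi E c (n + n) JD v)) ∧ IsOpen (K₁ : Set (UnitaryGroup.localPi E c (n + n) JD v))) ∧
      ∀ g : UnitaryGroup.localPi E c (n + n) JD v,
        ∃ p, IsSiegelDelta F E c hcδ hδ hd v n hT₀ hJD p ∧ ∃ k ∈ K₁, g = p * k := by
  classical
  -- the rational frame `Q` (as in ★ `exists_isSiegelDelta_mul_mem_localInt`)
  set D : Matrix (Fin n) (Fin n) F := (2 : F)⁻¹ • (T₀⁻¹ * (1 : Matrix (Fin n) (Fin n) F).submatrix id Fin.rev) with hD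
  set Qm : Matrix (Fin (n + n)) (Fin (n + n)) F := Matrix.reindex (e₂ n) (e₂ n) (Matrix.fromBlocks 1 D 1 (-D)) with hQm
  set Qi : Matrix (Fin (n + n)) (Fin (n + n)) F := Matrix.reindex (e₂ n) (e₂ n)
    (Matrix.fromBlocks ((2 : F)⁻¹ • (1 : Matrix (Fin n) (Fin n) F)) ((2 : F)⁻¹ • 1)
      ((1 : Matrix (Fin n) (Fin n) F).submatrix Fin.rev id * T₀) (-((1 : Matrix (Fin n) (Fin n) F).submatrix Fin.rev id * T₀))) with hQi
  have hmul : Qm * Qi = 1 := by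
    rw [hQm, hQi, reindex_mul_reindex, hD, frame_mul_frameInv hT₀d, Matrix.reindex_apply, Matrix.submatrix_one_equiv]
  have hmul' : Qi * Qm = 1 := by
    rw [hQm, hQi, reindex_mul_reindex, hD, frameInv_mul_frame hT₀d, Matrix.reindex_apply, Matrix.submatrix_one_equiv]
  let Q : GL (Fin (n + n)) F := ⟨Qm, Qi, hmul, hmul'⟩
  have hQval : (Q : Matrix (Fin (n + n)) (Fin (n + n)) F) = Matrix.reindex (e₂ n) (e₂ n) (Matrix.fromBlocks 1 D 1 (-D)) := rfl
  have hQ : (Q : Matrix (Fin (n + n)) (Fin (n + n)) F)ᵀ * gramD F n T₀ * (Q : Matrix (Fin (n + n)) (Fin (n + n)) F) =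
      (StdForm.antidiagonal (n + n)).over F := by
    rw [hQval, gramD, Matrix.transpose_reindex, reindex_mul_reindex, reindex_mul_reindex, hD, frame_transpose_mul_gram_mul_frame hT₀ hT₀d,
      reindex_antidiag_eq_antidiagonal_over]
  -- the transport `θ = frameConj Q : U(J_{2n})(F_v) ≃ₜ* H(F_v)` and the compact `K₁ := θ (U(J_{2n})(𝒪_v))`
  set θ := FrameTransport.frameConj F E c v (n + n) hJD (antidiagonal_over_eq_map F E n) Q hQ with hθ
  refine ⟨(UnitaryGroup.localInt E c (n + n) ((StdForm.antidiagonal (n + n)).over E) v).map θ.toMulEquiv.toMonoidHom, ⟨?_, ?_⟩, fun g => ?_⟩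
  · rw [Subgroup.coe_map]
    exact (UnitaryGroup.isCompact_localInt E c (n + n) _ v).image θ.continuous
  · rw [Subgroup.coe_map]
    exact θ.toHomeomorph.isOpenMap _ (UnitaryGroup.isOpen_localInt E c (n + n) _ v)
  · obtain ⟨b', k', hb', hk', hbk⟩ :=
      UnitaryGroup.exists_upper_mul_mem_localInt c (galConj_ne_one_of_delta F E c hcδ hδ) (θ.symm g)
    refine ⟨θ b', isSiegelDelta_frameConj F E c hcδ hδ hd v n hT₀ hJD D Q hQval hQ b' hb', θ k', ⟨k', hk', rfl⟩, ?_⟩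
    calc g = θ (θ.symm g) := (ContinuousMulEquiv.apply_symm_apply θ g).symm
      _ = θ b' * θ k' := by rw [hbk, map_mul]

end Generic

/-! ## §2 The CM doubled datum, in ★ p863501's binder shape -/

section CM

open Literature.NumberTheory.GelbartRogawski1991 Literature.NumberTheory.GelbartRogawski1991.GRConstruction
open Literature.NumberTheory.GelbartRogawski1991.UnitaryDualPair

variable (L : Type) [Field L] [NumberField L] [IsCMField L] {N M n : ℕ} (e : Fin N × Fin M ≃ Fin n)
  (dV : Fin N → L) (hdV : ∀ i, IsCMField.complexConj L (dV i) = dV i) (hdV0 : ∀ i, dV i ≠ 0)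
  (dW : Fin M → L) (hdW : ∀ i, IsCMField.complexConj L (dW i) = dW i) (hdW0 : ∀ i, dW i ≠ 0)
  (v : HeightOneSpectrum (𝓞 (Fp L)))

include hdV0 hdW0 in
set_option maxHeartbeats 800000 in -- measured: RED at the default 200 000 (`whnf` on the CM carrier + the `haveI` binder shape), GREEN at 800 000
/-- **FILE D OF ROAD (R2′): AT EVERY FINITE PLACE OF `L⁺` THE DOUBLED CM UNITARY GROUP `H(L⁺_v)` HAS A COMPACT OPEN IWASAWA SUBGROUP** — in ★ p863501
`exists_localFace_kindOneSingular`'s binder shape `K₀ hK₀ hIw` EXACTLY: `∃ K₀, (IsCompact K₀ ∧ IsOpen K₀) ∧ ∀ g, ∃ p, IsSiegelDelta … p ∧ ∃ k ∈ K₀, g = p·k`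
(§1 at `F := L⁺`, `E := L`, `c :=` complex conjugation, `δ := imagUnit L`, `T₀ := gramR` with ★ `isUnit_det_gramR₀`).  Class-free, every place, no goodness
hypothesis. [cite: BruhatTits1972, Prop. (4.4.3)] [cite: Casselman1980, §3] [cite: HarrisKudlaSweet1996, §1 (1.11)] -/
theorem exists_isCompact_isOpen_iwasawa_cm :
    ∃ K₀ : Subgroup (UnitaryGroup.localPi L (IsCMField.complexConj L) (n + n) (hermD L e dV hdV dW hdW) v),
      (IsCompact (K₀ : Set (UnitaryGroup.localPi L (IsCMField.complexConj L) (n + n) (hermD L e dV hdV dW hdW) v)) ∧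
        IsOpen (K₀ : Set (UnitaryGroup.localPi L (IsCMField.complexConj L) (n + n) (hermD L e dV hdV dW hdW) v))) ∧
      (haveI : Algebra.IsQuadraticExtension (Fp L) L := IsCMField.isQuadraticExtension L
        ∀ g : UnitaryGroup.localPi L (IsCMField.complexConj L) (n + n) (hermD L e dV hdV dW hdW) v,
          ∃ p, IsSiegelDelta (Fp L) L (IsCMField.complexConj L) (complexConj_imagUnit L) (imagUnit_ne_zero L) (imagUnit_mul_self L)
            v n (gramR_isSymm L e dV hdV dW hdW) (hermD_eq_map_gramD L e dV hdV dW hdW) p ∧ ∃ k ∈ K₀, g = p * k) := by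
  haveI : Algebra.IsQuadraticExtension (Fp L) L := IsCMField.isQuadraticExtension L
  obtain ⟨K₀, hK₀, hIw⟩ := exists_isCompact_isOpen_iwasawa (Fp L) L (IsCMField.complexConj L) (complexConj_imagUnit L) (imagUnit_ne_zero L)
    (imagUnit_mul_self L) v n (gramR_isSymm L e dV hdV dW hdW) (hermD_eq_map_gramD L e dV hdV dW hdW) (isUnit_det_gramR₀ L e dV hdV hdV0 dW hdW hdW0)
  exact ⟨K₀, hK₀, hIw⟩

end CM

end Summit.HodgeConjecture.HodgeConjecture.Cruxes.HLiu418.K2LiuLocalIwasawaCompact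

end
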